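import Summits.QuantumFields.YangMills.Theorems.FlatTubeReductionNearFlatRatioLaw
import Summits.QuantumFields.YangMills.Theorems.FemtoCutoffLadderFixedLatticeLawOfNearFlat
import HarnessLib

/-!
# ★★★★ Crux `FixedLatticeLaw` of route `FemtoCutoffLadder` (stmt-QuantumFields-23943) — the fixed-lattice semiclassical Lüscher law for EVERY `L`,
# closed from the PROVED crux K1 `NearFlatRatioLaw` of route `FlatTubeReduction`; the tree leaf `FemtoTransferGap.FemtoGapFixedLattice` DISCHARGED
# (seat `ym-line-ftr-p1` g21, booked «FCL LAYER-2 on node 23943»; R2b1 RECORD rung — a fixed-lattice statement; no summit statement is proved here)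

The flat-tube reduction delivers FCL's fixed-lattice node: `FixedLatticeLaw ⇐ K1 ∧ K2` with
* K1 = ✓`FlatTubeReduction.nearFlatRatioLaw_proof : Theses.FlatTubeReduction.NearFlatRatioLaw` (stmt-QuantumFields-24720, line «ratepack_v2»,
  `Theorems/FlatTubeReductionNearFlatRatioLaw.lean`): Born–Oppenheimer ratio law in the flat action tube `{S ≤ β^{−θ}}` at relative precision `λ_b²/L`
  against the one-site levels at coupling `L³β`;
* K2 = ✓`FemtoCutoffLadder.offTubeSuppression` (off-tube suppression), already consumed inside the landed glue
  ✓`FemtoCutoffLadder.fixedLatticeLaw_of_nearFlat` / ✓`femtoGapFixedLattice_of_nearFlat` (`Theorems/FemtoCutoffLadderFixedLatticeLawOfNearFlat.lean`, seat fcl-p3 g2),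
  whose hypothesis is the verbatim body of `NearFlatRatioLaw`.
Composition (K1 unfolds definitionally to the glue's hypothesis):
* ★★★★ `FemtoCutoffLadder.fixedLatticeLaw_proof : Theses.FemtoCutoffLadder.FixedLatticeLaw` — the item's decl BY NAME;
* ★★★★ `FemtoTransferGap.femtoGapFixedLattice_holds : FemtoGapFixedLattice` — the `@[conjecture]` tree leaf of `Theorems/FemtoTransferGap.lean` §3
  («OPEN as stated (no proof in print)», the `L = 1` case being crux ONE of route `LuscherReduction`) is now a THEOREM for every `L`;
  (its `L = 1` instance `FemtoGapOneSite` was already the theorem `femtoGapOneSite_proof`.)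
HONEST FRAMING: on every FIXED spatial lattice `(ℤ/L)³`, eventually in `β`: `λ₁ ≤ exp(−(ε₁λ_b − C_L λ_b²)/L)·λ₀`, `λ_b = (2/β)^{1/3}`, with an `L`-DEPENDENT
constant `C_L` — finite-dimensional multi-well semiclassics; this is NOT uniform in `L`, NOT infinite volume, NOT a mass gap, NOT Clay; rung R2b1 (`FemtoGapOfRecord`) stays OPEN
(open cruxes 24153 `OctaveStepDecay`, 26796 `UpStepEv`); no summit statement is proved here.  No `sorry`, no definitions, no named-fact hypotheses.
-/

set_option autoImplicit false

namespace Summit.QuantumFields.YangMills.Theorems.FemtoCutoffLadder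

/-- ★★★★ **Crux `FixedLatticeLaw` (stmt-QuantumFields-23943) BY NAME**: the landed glue `fixedLatticeLaw_of_nearFlat` (K2 `offTubeSuppression` inside) applied to the proved
crux K1 `FlatTubeReduction.nearFlatRatioLaw_proof` (its statement `Theses.FlatTubeReduction.NearFlatRatioLaw` unfolds to the glue's hypothesis). [cite: Luscher1983, §3]
[cite: LuscherMunster1984, §2] -/
theorem fixedLatticeLaw_proof : Summit.QuantumFields.YangMills.Theses.FemtoCutoffLadder.FixedLatticeLaw :=
  fixedLatticeLaw_of_nearFlat Summit.QuantumFields.YangMills.Theorems.FlatTubeReduction.nearFlatRatioLaw_proof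

end Summit.QuantumFields.YangMills.Theorems.FemtoCutoffLadder

namespace Summit.QuantumFields.YangMills.Theorems.FemtoTransferGap

/-- ★★★★ **The tree leaf `FemtoGapFixedLattice` DISCHARGED** — the fixed-lattice semiclassical Lüscher law on `(ℤ/L)³` for every `L`:
`∀ L, ∃ C β₀, ∀ β ≥ β₀, λ₁(β,L) ≤ exp(−(ε₁λ_b − Cλ_b²)/L)·λ₀(β,L)`; by the landed glue `FemtoCutoffLadder.femtoGapFixedLattice_of_nearFlat` (K2 inside) applied to the
proved crux K1 `FlatTubeReduction.nearFlatRatioLaw_proof`. [cite: Luscher1983, §3] [cite: LuscherMunster1984, §2] -/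
theorem femtoGapFixedLattice_holds : FemtoGapFixedLattice :=
  FemtoCutoffLadder.femtoGapFixedLattice_of_nearFlat Summit.QuantumFields.YangMills.Theorems.FlatTubeReduction.nearFlatRatioLaw_proof

end Summit.QuantumFields.YangMills.Theorems.FemtoTransferGap
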